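import Summits.AtomisticToContinuum.BoseEinsteinCondensation.Cruxes.NearIsotropicDiluteBEC.CruxImpliesC
import Summits.AtomisticToContinuum.BoseEinsteinCondensation.Cruxes.NearIsotropicDiluteBEC.Lines.birth

/-!
# Strategist certificate (REDIRECT r1, 2026-08-17) for the deciding crux `NearIsotropicDiluteBEC`
# (stmt-AtomisticToContinuum-13905, route `BECZeroCrossingDilute`)

Kernel-checked content of the STRATEGY-CENSUS verdict `no-strategy`:

1. `crux_iff_thermodynamicWindow` — the crux is EQUIVALENT to the thermodynamic-window statement
   `ThermodynamicWindowPersistence` (= registered stub C `stub_thermodynamicWindow` of line `birth`), because the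
   kinetic-gap (Gross–Pitaevskii) window is LANDED (`stub_gapWindow`, p156039) and the Perron stub A is LANDED
   (p148797): `→` is `thermodynamicWindow_of_crux` (tree `Cruxes/NearIsotropicDiluteBEC/CruxImpliesC.lean`),
   `←` is the skeleton composition `NearIsotropicDiluteBEC_of` (tree `Cruxes/NearIsotropicDiluteBEC/Lines/birth.lean`).
   Hence every decomposition {GP window, thermodynamic window} has a piece ≡ crux (BC2 (c) fails), and the crux's
   whole open content is the thermodynamic window `κL ≤ (1−Δ)N`.

2. `thermodynamicLimit_of_crux` — the crux contains the THERMODYNAMIC LIMIT AT FIXED POSITIVE DENSITY AND FIXED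
   COUPLING: from the crux one gets `ε, ν₀ > 0` such that along `L → ∞`, `N_L = ⌊ν₀L³⌋`, `Δ = 1 − ε` the sector ground
   state keeps half of the `SU(2)` condensate, i.e. Bose–Einstein condensation (condensate fraction ≥ ½·(1 − ν₀)) of the
   interacting hard-core lattice Bose gas (hopping ½, nearest-neighbour attraction `1 − ε`) at density `ν₀` uniformly in
   the volume — the lattice instance of the sub-problem's own open content (`HasGroundStateBEC v ρ` at fixed `ρ`,
   `L = (N/ρ)^{1/3} → ∞`), inside `Literature.Barriers.AtomisticToContinuum.BogoliubovPerturbationInfrared` and outside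
   `HalfFillingReflectionPositivity` (no reflection positivity for ferromagnetic z-coupling / off half filling).

Both are logic over tree theorems; no `sorry` here (the imported skeleton carries the one `sorry` of stub C, unused).
-/

noncomputable section

namespace Summit.AtomisticToContinuum.BoseEinsteinCondensation.Cruxes.NearIsotropicDiluteBEC.Strategist

open scoped BigOperators Matrix ComplexOrder
open Literature.MathematicalPhysics.QuantumLattice Literature.Probability.LatticeModels Matrix
open Summit.AtomisticToContinuum.BoseEinsteinCondensation.Theses.BECZeroCrossingDilute
open Summit.AtomisticToContinuum.BoseEinsteinCondensation.Cruxes.NearIsotropicDiluteBEC.Birth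

/-- **The crux is its thermodynamic window.** `NearIsotropicDiluteBEC ↔ ThermodynamicWindowPersistence`
(stub C of line `birth`), by the landed kinetic-gap window B (p156039) and Perron stub A (p148797):
`→` = `thermodynamicWindow_of_crux`, `←` = `NearIsotropicDiluteBEC_of`. [folklore] -/
theorem crux_iff_thermodynamicWindow :
    NearIsotropicDiluteBEC ↔ ThermodynamicWindowPersistence :=
  ⟨fun h => thermodynamicWindow_of_crux h, fun h => NearIsotropicDiluteBEC_of h⟩

/-- **The crux contains the thermodynamic limit at fixed density and fixed coupling.** Specialising the crux
to `N = ⌊ν₀L³⌋`, `Δ = 1 − ε`: for ALL `L ≥ 2` the tracial sector ground state of the penalised easy-plane XXZ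
ferromagnet at density `⌊ν₀L³⌋/L³ → ν₀` and anisotropy `1 − ε` satisfies `N(L³ − N + 1) ≤ 2·B_L(N, 1−ε)`, i.e.
`⟨S⁺_tot S⁻_tot⟩ ≥ ½ N (L³ − N + 1)` — Bose–Einstein condensation of an interacting lattice Bose gas at positive
density in the infinite-volume limit. [folklore] -/
theorem thermodynamicLimit_of_crux (hX : NearIsotropicDiluteBEC) :
    ∃ ε ν₀ : ℝ, 0 < ε ∧ 0 < ν₀ ∧ ∀ (L : ℕ) [NeZero L], 2 ≤ L →
      ((⌊ν₀ * (L : ℝ) ^ 3⌋₊ : ℕ) : ℝ) * ((L : ℝ) ^ 3 - (⌊ν₀ * (L : ℝ) ^ 3⌋₊ : ℕ) + 1) ≤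
        2 * (((penalised L ⌊ν₀ * (L : ℝ) ^ 3⌋₊ (1 - ε)).groundStateFunctional (planarSq L)).re +
          (⌊ν₀ * (L : ℝ) ^ 3⌋₊ : ℕ) - (L : ℝ) ^ 3 / 2) := by
  obtain ⟨ε, ν₀, hε, hν₀, hP⟩ := hX
  refine ⟨ε, ν₀, hε, hν₀, ?_⟩
  intro L _ hL
  have hL3 : (0 : ℝ) ≤ ν₀ * (L : ℝ) ^ 3 := by positivity
  have hN : ((⌊ν₀ * (L : ℝ) ^ 3⌋₊ : ℕ) : ℝ) ≤ ν₀ * (L : ℝ) ^ 3 := Nat.floor_le hL3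
  exact hP L hL ⌊ν₀ * (L : ℝ) ^ 3⌋₊ hN (1 - ε) le_rfl (by linarith)

/-- The kinetic-gap (Gross–Pitaevskii) window of the crux is a THEOREM of the tree (p156039): the banked artefact. -/
example : GapWindowPersistence := gapWindow_holds

end Summit.AtomisticToContinuum.BoseEinsteinCondensation.Cruxes.NearIsotropicDiluteBEC.Strategist

end
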